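/-
PORT (pub-hodgecm2, COR-CM cell; slot b19 = executor of row Fg6, successor of model-2) — part 1/2 of the MINIMAL F6 CONE of the stage-1
package file `HodgeCMPerL/HodgeCM/StubTree/Qw8Monomial.lean` (pub-hodgecm HOME/lean, bytes of record md5 c9b36976df57, 894 lines):
its §§2–5 (source ll. 126–306: dimension and trace bookkeeping, concatenation of cup powers, index bookkeeping) VERBATIM.  §1 (the
generic facts `Fact_dimProd`/`Fact_trTop`/`Fact_trTopCM`, `trTopCM_of_trTop`) is the relocation file `Geometry/GenericFacts.lean`
(seat b20), imported here; §§6–8 are part 2/2 (`StubTree/Qw8Monomial2.lean`); §§9–11 (a re-proof of [QW8] Thm 2.5 from the generic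
facts, needing `StubTree.Qw8Milne`) are NOT ported — off the COR-CM chain (CHAIN-MAP R07), portable later on top of part 2.  Edits:
imports re-pointed to the LOWEST tree modules declaring what these sections use (`StubTree.Qw8GeometricBlocks` for
`Fact_cupAssoc`/`cupC_assoc`, `Proofs.Pohlmann.WeightSpan` for `wtOf`/`cupPowC`) instead of the package's `StubTree.Qw8Milne`;
namespace token `HodgeCM` ↦ `Summit.HodgeConjecture.CorCM`; linter fixes (stub docstrings).  Generator: pub-hodgecm2-p1 portkit
`build_kit.py` (model-2's run, MANIFEST-portF6), re-cut by hand at section boundaries (b19).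
-/
import Summits.HodgeConjecture.CorCM.Geometry.GenericFacts
import Summits.HodgeConjecture.CorCM.StubTree.Qw8GeometricBlocks
import Summits.HodgeConjecture.CorCM.Proofs.Pohlmann.WeightSpan
import Mathlib.RingTheory.Flat.Basic
import HarnessLib

/-!
# The monomial calculus for F6, I: dimension / trace / cup-power / index bookkeeping

Port of §§2–5 of the package's `StubTree/Qw8Monomial.lean` ("[QW8] Thm 2.5 (ii), (iii)+(v) and the degree-0 residue by the
MONOMIAL CALCULUS — without F2 and F6").  Purpose in this cell (row Fg6 of `BINDER-OWNERS.md`): F6 `Universe.Fact_weightDual`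
(`StubTree/Qw8GeometricBlocks.lean`) is a THEOREM of `ModelAxioms`, N1 `Fact_cupExterior`, F5 `Fact_cupAssoc` and the generic facts
`Fact_dimProd`, `Fact_trTopCM`, `Fact_unitH0` of `Geometry/GenericFacts.lean` (`StubTree/WeightDualUnit.lean`,
`Universe.weightDual_of_unitH0`); the generic facts are proved for the model of record in `CorCM/Model/WeightDual.lean`.

Contents (verbatim): `two_mul_halfDegree`, `dim_prodFin`, `dim_cmProd`, `two_mul_dim_cmProd_of_dimProd`, `card_index` (§2:
`2 dim ∏_j A_{Θ_j} = (n+1)[F:ℚ]`); `trC_injective_of_injective`, `trC_top_injective` (§3: the complexified top trace);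
`cupC_assoc'`, `cupPowC_snoc`, `cupC_cupPowC_cupPowC` (§4: concatenation of cup powers, F5); `append_comp_eq`, `mem_wtOf_iff`,
`wtOf_eq_univ_of_surjective`, `wtOf_eq_compl`, `wtOf_liftA/B`, `exists_compl_enum` (§5: weights of monomials, complementary
enumerations).  None of these statements mentions algebraic cycles or Hodge classes.
-/

noncomputable section

open scoped TensorProduct NumberField Classical

namespace Summit.HodgeConjecture.CorCM

open Literature.AlgebraicGeometry.Motives (CMType)

namespace Universe

variable {U : Universe}

/-! ## 2. Dimension and degree bookkeeping -/

omit U in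
/-- (Ported verbatim from the stage-1 package `HodgeCM/StubTree/Qw8Monomial.lean`; no docstring in the source.) -/
theorem two_mul_halfDegree (F : CMField) : 2 * F.halfDegree = Module.finrank ℚ F := by
  unfold CMField.halfDegree
  have h := NumberField.IsTotallyComplex.finrank (K := (F : Type))
  omega

/-- (Ported verbatim from the stage-1 package `HodgeCM/StubTree/Qw8Monomial.lean`; no docstring in the source.) -/
theorem dim_prodFin (hd : U.Fact_dimProd) : ∀ (n : ℕ) (X : Fin (n + 1) → U.Var),
    U.dim (U.prodFin n X) = ∑ i, U.dim (X i)
  | 0, X => by simp [prodFin]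
  | n + 1, X => by
    rw [prodFin, hd, dim_prodFin hd n]
    exact (Fin.sum_univ_castSucc fun i => U.dim (X i)).symm

/-- (Ported verbatim from the stage-1 package `HodgeCM/StubTree/Qw8Monomial.lean`; no docstring in the source.) -/
theorem dim_cmProd (M : U.ModelAxioms) (hd : U.Fact_dimProd) (F : CMField) {n : ℕ} (Θ : Fin (n + 1) → CMType F) :
    U.dim (U.cmProd F Θ) = (n + 1) * F.halfDegree := by
  have h : ∀ Φ : CMType F, U.dim (U.cmAV F Φ) = F.halfDegree := fun Φ => (M.cmAV F Φ).2.2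
  unfold cmProd
  rw [dim_prodFin hd]
  simp only [h, Finset.sum_const, Finset.card_univ, Fintype.card_fin, smul_eq_mul]

/-- `2 dim ∏_{j ≤ n} A_{Θ_j} = (n+1)[F:ℚ] = dim_ℚ H¹`. -/
theorem two_mul_dim_cmProd_of_dimProd (M : U.ModelAxioms) (hd : U.Fact_dimProd) (F : CMField) {n : ℕ}
    (Θ : Fin (n + 1) → CMType F) : 2 * U.dim (U.cmProd F Θ) = (n + 1) * Module.finrank ℚ F := by
  rw [dim_cmProd M hd F Θ, ← two_mul_halfDegree]; ring

omit U in
/-- The index set of the eigen-forms `e_{j,s}` of `∏_{j ≤ n} A_{Θ_j}` has `(n+1)[F:ℚ]` elements. -/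
theorem card_index (F : CMField) (n : ℕ) :
    Fintype.card (Fin (n + 1) × ((F : Type) →+* ℂ)) = (n + 1) * Module.finrank ℚ F := by
  rw [Fintype.card_prod, Fintype.card_fin, NumberField.Embeddings.card]

/-! ## 3. The trace with complex coefficients in top degree -/

/-- (Ported verbatim from the stage-1 package `HodgeCM/StubTree/Qw8Monomial.lean`; no docstring in the source.) -/
theorem trC_injective_of_injective {X : U.Var} {k : ℕ} (h : Function.Injective (U.tr X k)) :
    Function.Injective (U.trC X k) := by
  have hb : Function.Injective ((U.tr X k).baseChange ℂ) := by
    rw [LinearMap.baseChange_eq_ltensor]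
    exact Module.Flat.lTensor_preserves_injective_linearMap _ h
  unfold trC
  rw [LinearMap.coe_comp]
  exact (LinearEquiv.injective _).comp hb

/-- (Ported verbatim from the stage-1 package `HodgeCM/StubTree/Qw8Monomial.lean`; no docstring in the source.) -/
theorem trC_top_injective (ht : U.Fact_trTopCM) (F : CMField) {n : ℕ} (Θ : Fin (n + 1) → CMType F) :
    Function.Injective (U.trC (U.cmProd F Θ) (2 * U.dim (U.cmProd F Θ))) :=
  trC_injective_of_injective (ht F n Θ)

/-! ## 4. Concatenation of cup powers (F5) -/

/-- `a ∪ (b ∪ c) = cast ((a ∪ b) ∪ c)` — F5 with complex coefficients, solved for the right-nested product. -/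
theorem cupC_assoc' (h5 : U.Fact_cupAssoc) (X : U.Var) (i j k : ℕ) (a : U.CohC X i) (b : U.CohC X j)
    (c : U.CohC X k) :
    U.cupC X i (j + k) a (U.cupC X j k b c) = U.castC X (Nat.add_assoc i j k) (U.cupC X (i + j) k (U.cupC X i j a b) c) := by
  rw [cupC_assoc U h5, castC_castC, castC_self]

/-- (Ported verbatim from the stage-1 package `HodgeCM/StubTree/Qw8Monomial.lean`; no docstring in the source.) -/
theorem cupPowC_snoc (X : U.Var) (K : ℕ) (w : Fin (K + 1) → U.CohC X 1) (c : U.CohC X 1) :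
    U.cupPowC X (K + 1) (Fin.snoc w c) = U.cupC X (K + 1) 1 (U.cupPowC X K w) c := by
  rw [cupPowC_succ_apply]
  simp only [Fin.init_snoc, Fin.snoc_last]

/-- **Concatenation**: `(u₀ ∪ ⋯ ∪ u_k) ∪ (v₀ ∪ ⋯ ∪ v_l) = u₀ ∪ ⋯ ∪ u_k ∪ v₀ ∪ ⋯ ∪ v_l` (F5). -/
theorem cupC_cupPowC_cupPowC (h5 : U.Fact_cupAssoc) (X : U.Var) (k : ℕ) (u : Fin (k + 1) → U.CohC X 1) (l : ℕ) :
    ∀ v : Fin (l + 1) → U.CohC X 1,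
      U.cupC X (k + 1) (l + 1) (U.cupPowC X k u) (U.cupPowC X l v) =
        U.cupPowC X (k + 1 + l) (Fin.append u v : Fin (k + 1 + (l + 1)) → U.CohC X 1) := by
  induction l with
  | zero =>
    intro v
    rw [cupPowC_zero_apply, Fin.append_right_eq_snoc]
    exact (U.cupPowC_snoc X k u (v 0)).symm
  | succ l ih =>
    intro v
    have hv : (Fin.append u v : Fin (k + 1 + (l + 1 + 1)) → U.CohC X 1) =
        Fin.snoc (Fin.append u (Fin.init v)) (v (Fin.last (l + 1))) := by
      rw [← Fin.append_snoc, Fin.snoc_init_self]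
    rw [cupPowC_succ_apply X l v, U.cupC_assoc' h5, ih (Fin.init v), hv]
    show _ = U.cupPowC X (k + 1 + l + 1)
      (Fin.snoc (Fin.append u (Fin.init v) : Fin (k + 1 + (l + 1)) → U.CohC X 1) (v (Fin.last (l + 1))))
    rw [U.cupPowC_snoc X (k + 1 + l)]
    rfl


/-! ## 5. Index bookkeeping: `Fin.append`, weights of monomials, complementary enumerations -/

section Index

omit U

/-- (Ported verbatim from the stage-1 package `HodgeCM/StubTree/Qw8Monomial.lean`; no docstring in the source.) -/
theorem append_comp_eq {α β : Type*} {a b : ℕ} (f : α → β) (p : Fin a → α) (p' : Fin b → α) :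
    (Fin.append (f ∘ p) (f ∘ p') :) = f ∘ (Fin.append p p' :) := by
  funext i
  refine Fin.addCases (fun j => ?_) (fun j => ?_) i <;> simp

variable {F : CMField} {n : ℕ}

/-- (Ported verbatim from the stage-1 package `HodgeCM/StubTree/Qw8Monomial.lean`; no docstring in the source.) -/
theorem mem_wtOf_iff {k : ℕ} (p : Fin (k + 1) → Fin (n + 1) × ((F : Type) →+* ℂ)) (j : Fin (n + 1))
    (s : (F : Type) →+* ℂ) : s ∈ wtOf k p j ↔ (j, s) ∈ Set.range p := by
  simp only [wtOf, Finset.mem_image, Finset.mem_filter, Finset.mem_univ, true_and, Set.mem_range]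
  constructor
  · rintro ⟨i, hi, his⟩
    exact ⟨i, Prod.ext hi his⟩
  · rintro ⟨i, hi⟩
    exact ⟨i, by rw [hi], by rw [hi]⟩

/-- A surjective index map has the full weight `(univ)_j`. -/
theorem wtOf_eq_univ_of_surjective {k : ℕ} {p : Fin (k + 1) → Fin (n + 1) × ((F : Type) →+* ℂ)}
    (hp : Function.Surjective p) : wtOf k p = fun _ => Finset.univ := by
  funext j; ext s
  simp only [mem_wtOf_iff, Finset.mem_univ, iff_true]
  exact hp (j, s)

/-- The weight of a COMPLEMENTARY enumeration is the complementary weight. -/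
theorem wtOf_eq_compl {k l : ℕ} {p : Fin (k + 1) → Fin (n + 1) × ((F : Type) →+* ℂ)}
    {p' : Fin (l + 1) → Fin (n + 1) × ((F : Type) →+* ℂ)} (h1 : ∀ t, p' t ∉ Set.range p)
    (h2 : ∀ z, z ∉ Set.range p → z ∈ Set.range p') : wtOf l p' = fun j => (wtOf k p j)ᶜ := by
  funext j; ext s
  rw [Finset.mem_compl, mem_wtOf_iff, mem_wtOf_iff]
  constructor
  · rintro ⟨t, ht⟩ hmem
    exact h1 t (ht ▸ hmem)
  · exact h2 (j, s)

/-- The weight of a monomial LIFTED from the first block `j ↦ castAdd (m+1) j` is `(wtOf p, ∅)`. -/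
theorem wtOf_liftA {m k : ℕ} (p : Fin (k + 1) → Fin (n + 1) × ((F : Type) →+* ℂ)) :
    wtOf (n := n + 1 + m) k (fun i => (Fin.castAdd (m + 1) (p i).1, (p i).2)) =
      (Fin.append (wtOf k p) (fun _ : Fin (m + 1) => (∅ : Finset ((F : Type) →+* ℂ))) :) := by
  funext t; ext s
  rw [mem_wtOf_iff]
  refine Fin.addCases (m := n + 1) (n := m + 1) (fun j => ?_) (fun i => ?_) t
  · rw [Fin.append_left, mem_wtOf_iff]
    simp only [Set.mem_range, Prod.mk.injEq]
    constructor
    · rintro ⟨i, hi, his⟩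
      exact ⟨i, Prod.ext (Fin.castAdd_inj.mp hi) his⟩
    · rintro ⟨i, hi⟩
      exact ⟨i, by rw [hi], by rw [hi]⟩
  · rw [Fin.append_right]
    simp only [Set.mem_range, Prod.mk.injEq, Finset.notMem_empty, iff_false, not_exists, not_and]
    intro i hi
    exact absurd (congrArg Fin.val hi) (by simp; omega)

/-- The weight of a monomial LIFTED from the second block `i ↦ natAdd (n+1) i` is `(∅, wtOf p)`. -/
theorem wtOf_liftB {m k : ℕ} (p : Fin (k + 1) → Fin (m + 1) × ((F : Type) →+* ℂ)) :
    wtOf (n := n + 1 + m) k (fun i => (Fin.natAdd (n + 1) (p i).1, (p i).2)) =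
      (Fin.append (fun _ : Fin (n + 1) => (∅ : Finset ((F : Type) →+* ℂ))) (wtOf k p) :) := by
  funext t; ext s
  rw [mem_wtOf_iff]
  refine Fin.addCases (m := n + 1) (n := m + 1) (fun j => ?_) (fun i => ?_) t
  · rw [Fin.append_left]
    simp only [Set.mem_range, Prod.mk.injEq, Finset.notMem_empty, iff_false, not_exists, not_and]
    intro i hi
    exact absurd (congrArg Fin.val hi) (by simp; omega)
  · rw [Fin.append_right, mem_wtOf_iff]
    simp only [Set.mem_range, Prod.mk.injEq]
    constructor
    · rintro ⟨t, ht, hts⟩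
      exact ⟨t, Prod.ext (Fin.natAdd_inj _ |>.mp ht) hts⟩
    · rintro ⟨t, ht⟩
      exact ⟨t, by rw [ht], by rw [ht]⟩

/-- **Complementary enumeration**: an injective, non-surjective `p : Fin a → ι` has an injective enumeration
`p'` of the complement of its range, of length `card ι - a ≥ 1`. -/
theorem exists_compl_enum {ι : Type*} [Fintype ι] {a : ℕ} (p : Fin a → ι) (hp : Function.Injective p)
    (hs : ¬Function.Surjective p) :
    ∃ (l' : ℕ) (p' : Fin (l' + 1) → ι), Function.Injective p' ∧ (∀ t, p' t ∉ Set.range p) ∧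
      (∀ z, z ∉ Set.range p → z ∈ Set.range p') ∧ l' + 1 + a = Fintype.card ι := by
  classical
  let C : Set ι := (Set.range p)ᶜ
  have hcard : Fintype.card ι = a + Fintype.card C := by
    rw [← Fintype.card_congr (Equiv.Set.sumCompl (Set.range p)), Fintype.card_sum,
      ← Fintype.card_congr (Equiv.ofInjective p hp), Fintype.card_fin]
  have hCne : 0 < Fintype.card C := by
    obtain ⟨z, hz⟩ := not_forall.mp hs
    exact Fintype.card_pos_iff.mpr ⟨⟨z, by simpa [C, Set.mem_range] using hz⟩⟩
  obtain ⟨l', hl'⟩ := Nat.exists_eq_add_one_of_ne_zero hCne.ne'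
  let e : Fin (l' + 1) ≃ C := (finCongr hl'.symm).trans (Fintype.equivFin C).symm
  refine ⟨l', fun t => (e t).1, Subtype.val_injective.comp e.injective, fun t => (e t).2, fun z hz => ?_, by omega⟩
  exact ⟨e.symm ⟨z, hz⟩, by simp⟩

end Index

end Universe

end Summit.HodgeConjecture.CorCM

end
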